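import Literature.Topology.FourManifolds.OrientationChartSign

/-!
# The orientation character of a parametrisation

Topic `Literature/Topology/FourManifolds`; companion of `OrientationSign.lean` /
`OrientationChartSign.lean` (Hirsch, *Differential Topology* (1976), Ch. 4 §4), written for the
orientation law of the entrance sheets in the structure conjugacy of
`stmt-SmoothPoincare4-15190` on manifolds *with boundary* (model `𝓡∂ 3`), where the chart
criterion `SmoothOrientation.IsPosChart` of `OrientationChartSign.lean` (model `𝓘(ℝ, E)`) is not
available.  Everything here is **proved**, for an arbitrary model with corners `I` over `E`.

For a map `ψ : E → M` (a parametrisation by the model vector space) let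

* `pushFrame I ψ u` — the frame `dψ_u (b₁), …, dψ_u (bₙ)` of `T_{ψ u} M` (read in the preferred
  chart at `ψ u`), `b = Module.finBasis ℝ E`.

Then:

* `SmoothOrientation.isPosFrame_pushFrame_iff_of_isPreconnected` — **on a preconnected open set
  where `ψ` is `C^∞` with non-degenerate pushed frame, the orientation character of the pushed
  frame is constant** (`SmoothOrientation.isPosFrame_iff_of_isPreconnected`; the pushed frame
  moves continuously in `TM` by continuity of the tangent map);
* `SmoothOrientation.isPosFrame_pushFrame_iff_of_comp` — **transition rule**: if at a common
  point `dψ₁ = dψ₂ ∘ J` then the pushed frame of `ψ₁` is positive iff (the pushed frame of `ψ₂`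
  is positive iff `0 < det J`);
* `det_pushFrame_ne_zero_of_comp_eq_id` — the pushed frame is non-degenerate when `ψ` has a
  differentiable left inverse.

So two parametrisations with connected domains have transition Jacobians of one sign on the
whole overlap of their images, connected or not (Hirsch, Ch. 4 §4, remark after Lemma 4.1).

## References

* M. W. Hirsch, *Differential Topology*, GTM 33, Springer (1976), Ch. 4 §4. [HirschDT1976]
* J. M. Lee, *Introduction to Smooth Manifolds*, 2nd ed. (2013), Ch. 15, Prop. 15.5–15.6.
  [LeeSmoothManifolds2013]
-/

open scoped Manifold ContDiff Topology
open Set Function Module Bundle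

noncomputable section

namespace Literature.Topology.FourManifolds

variable {E H : Type*} [NormedAddCommGroup E] [NormedSpace ℝ E] [FiniteDimensional ℝ E] [TopologicalSpace H]
  (I : ModelWithCorners ℝ E H) {M : Type*} [TopologicalSpace M] [ChartedSpace H M]

/-- **The pushed frame** of a parametrisation `ψ : E → M` at `u`: the images `dψ_u (bᵢ)` of the
reference basis `Module.finBasis ℝ E`, vectors of `T_{ψ u} M` read in the preferred chart at
`ψ u`. [cite: LeeSmoothManifolds2013, Ch. 15 (oriented frames)] -/
def pushFrame (ψ : E → M) (u : E) : Fin (finrank ℝ E) → E :=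
  fun i => mfderiv 𝓘(ℝ, E) I ψ u (finBasis ℝ E i)

variable {I}

/-- Unfolding of `pushFrame`. [folklore] -/
@[simp] theorem pushFrame_apply (ψ : E → M) (u : E) (i : Fin (finrank ℝ E)) :
    pushFrame I ψ u i = mfderiv 𝓘(ℝ, E) I ψ u (finBasis ℝ E i) := rfl

/-- The determinant of the pushed frame is the determinant of `dψ_u` (as an endomorphism of the
model space). [folklore] -/
theorem det_pushFrame (ψ : E → M) (u : E) :
    (finBasis ℝ E).det (pushFrame I ψ u) = LinearMap.det (M := E) (mfderiv 𝓘(ℝ, E) I ψ u).toLinearMap := by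
  have h := basis_det_clm_apply (finBasis ℝ E) (mfderiv 𝓘(ℝ, E) I ψ u) (finBasis ℝ E)
  rw [Basis.det_self, mul_one] at h
  exact h

variable [IsManifold I ∞ M]

/-- **The pushed frame moves continuously in `TM`** over an open set where `ψ` is `C^∞`. [folklore] -/
theorem continuousOn_totalSpace_pushFrame {ψ : E → M} {U : Set E} (hU : IsOpen U)
    (hψ : ContMDiffOn 𝓘(ℝ, E) I ∞ ψ U) (i : Fin (finrank ℝ E)) :
    ContinuousOn (fun u => (⟨ψ u, (pushFrame I ψ u i : E)⟩ : TangentBundle I M)) U := by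
  have h1 : ContinuousOn (tangentMapWithin 𝓘(ℝ, E) I ψ U) (π E (TangentSpace 𝓘(ℝ, E)) ⁻¹' U) :=
    hψ.continuousOn_tangentMapWithin (by simp) hU.uniqueMDiffOn
  have h0 : ContinuousOn (fun u : E => (u, finBasis ℝ E i)) U := continuousOn_id.prodMk continuousOn_const
  have h2 := (tangentBundleModelSpaceHomeomorph 𝓘(ℝ, E)).symm.continuous.comp_continuousOn h0
  have h3 := h1.comp h2 fun u hu => by
    show u ∈ U
    exact hu
  refine h3.congr fun u hu => ?_
  show (⟨ψ u, (pushFrame I ψ u i : E)⟩ : TangentBundle I M) = tangentMapWithin 𝓘(ℝ, E) I ψ U ⟨u, finBasis ℝ E i⟩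
  rw [tangentMapWithin, mfderivWithin_of_isOpen hU hu]
  rfl

namespace SmoothOrientation

/-- **The orientation character of the pushed frame is constant on preconnected open sets**
where the parametrisation is `C^∞` with non-degenerate pushed frame (Hirsch 1976, Ch. 4 §4:
orientations are locally constant, hence constant on connected sets). [cite: HirschDT1976, Ch. 4 §4 (after Lemma 4.1)] -/
theorem isPosFrame_pushFrame_iff_of_isPreconnected (o : SmoothOrientation I M) {ψ : E → M} {U : Set E}
    (hUo : IsOpen U) (hU : IsPreconnected U) (hψ : ContMDiffOn 𝓘(ℝ, E) I ∞ ψ U)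
    (hdet : ∀ u ∈ U, (finBasis ℝ E).det (pushFrame I ψ u) ≠ 0) {u u' : E} (hu : u ∈ U) (hu' : u' ∈ U) :
    o.IsPosFrame (ψ u) (pushFrame I ψ u) ↔ o.IsPosFrame (ψ u') (pushFrame I ψ u') :=
  o.isPosFrame_iff_of_isPreconnected hU (γ := ψ) (B := pushFrame I ψ) hψ.continuousOn
    (fun p => continuousOn_tangentCoordChange_frame_of_continuousOn
      (fun i => continuousOn_totalSpace_pushFrame hUo hψ i) p)
    hdet hu hu'

/-- **Transition rule.**  If two parametrisations meet, `ψ₁ u₁ = ψ₂ u₂`, with `dψ₁ = dψ₂ ∘ J`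
there, then the pushed frame of `ψ₁` is positive iff (the pushed frame of `ψ₂` is positive iff
`0 < det J`). [cite: HirschDT1976, Ch. 4 §4] -/
theorem isPosFrame_pushFrame_iff_of_comp (o : SmoothOrientation I M) {ψ₁ ψ₂ : E → M} {u₁ u₂ : E}
    (hx : ψ₁ u₁ = ψ₂ u₂) (J : E →L[ℝ] E)
    (hJ : ∀ v : E, mfderiv 𝓘(ℝ, E) I ψ₁ u₁ v = mfderiv 𝓘(ℝ, E) I ψ₂ u₂ (J v))
    (hdet₂ : (finBasis ℝ E).det (pushFrame I ψ₂ u₂) ≠ 0) (hJ0 : LinearMap.det (J : E →ₗ[ℝ] E) ≠ 0) :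
    o.IsPosFrame (ψ₁ u₁) (pushFrame I ψ₁ u₁) ↔ (o.IsPosFrame (ψ₂ u₂) (pushFrame I ψ₂ u₂) ↔ 0 < LinearMap.det (J : E →ₗ[ℝ] E)) := by
  have h1 : (finBasis ℝ E).det (pushFrame I ψ₁ u₁) =
      (finBasis ℝ E).det (pushFrame I ψ₂ u₂) * LinearMap.det (J : E →ₗ[ℝ] E) := by
    have h2 : pushFrame I ψ₁ u₁ = fun i => mfderiv 𝓘(ℝ, E) I ψ₂ u₂ (J (finBasis ℝ E i)) := by
      funext i; exact hJ _
    have h3 := basis_det_clm_apply (finBasis ℝ E) (mfderiv 𝓘(ℝ, E) I ψ₂ u₂) (fun i => J (finBasis ℝ E i))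
    have h4 := basis_det_clm_apply (finBasis ℝ E) J (finBasis ℝ E)
    rw [Basis.det_self, mul_one] at h4
    rw [h2]
    refine h3.trans ?_
    rw [h4, det_pushFrame]
    rfl
  unfold SmoothOrientation.IsPosFrame
  rw [hx, h1, ← mul_assoc]
  exact mul_pos_iff_pos_iff_pos (mul_ne_zero (o.sign_ne_zero _) hdet₂) hJ0

end SmoothOrientation

omit [IsManifold I ∞ M] in
/-- **The pushed frame is non-degenerate when the parametrisation has a differentiable left
inverse** near the point (chain rule: `dχ ∘ dψ = id`). [folklore] -/
theorem det_pushFrame_ne_zero_of_comp_eq_id {ψ : E → M} {χ : M → E} {u : E}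
    (hψ : MDifferentiableAt 𝓘(ℝ, E) I ψ u) (hχ : MDifferentiableAt I 𝓘(ℝ, E) χ (ψ u))
    (h : χ ∘ ψ =ᶠ[𝓝 u] id) : (finBasis ℝ E).det (pushFrame I ψ u) ≠ 0 := by
  -- `dχ ∘ dψ = id`, so `det_b (dχ (dψ bᵢ)) = 1 = det dχ * det_b (dψ bᵢ)`
  have h1 : ∀ v : E, mfderiv I 𝓘(ℝ, E) χ (ψ u) (mfderiv 𝓘(ℝ, E) I ψ u v) = v := fun v => by
    have h2 : mfderiv 𝓘(ℝ, E) 𝓘(ℝ, E) (χ ∘ ψ) u = (mfderiv I 𝓘(ℝ, E) χ (ψ u)).comp (mfderiv 𝓘(ℝ, E) I ψ u) :=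
      mfderiv_comp u hχ hψ
    have h3 : mfderiv 𝓘(ℝ, E) 𝓘(ℝ, E) (χ ∘ ψ) u = mfderiv 𝓘(ℝ, E) 𝓘(ℝ, E) (id : E → E) u := h.mfderiv_eq
    have h4 : mfderiv 𝓘(ℝ, E) 𝓘(ℝ, E) (id : E → E) u = ContinuousLinearMap.id ℝ (TangentSpace 𝓘(ℝ, E) u) := mfderiv_id
    have h5 := ContinuousLinearMap.ext_iff.1 (h2.symm.trans (h3.trans h4)) v
    exact h5
  obtain ⟨A, hA⟩ : ∃ A : E →ₗ[ℝ] E, ∀ v : E, A (mfderiv 𝓘(ℝ, E) I ψ u v) = v :=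
    ⟨(mfderiv I 𝓘(ℝ, E) χ (ψ u)).toLinearMap, h1⟩
  have hli : LinearIndependent ℝ (pushFrame I ψ u) := by
    apply LinearIndependent.of_comp A
    have h6 : ⇑A ∘ pushFrame I ψ u = ⇑(finBasis ℝ E) := by
      funext i; exact hA _
    rw [h6]
    exact (finBasis ℝ E).linearIndependent
  exact det_ne_zero_of_linearIndependent _ hli

end Literature.Topology.FourManifolds
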